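import Literature.NumberTheory.Automorphic.UnitaryDualPairDoubledLineStabiliser
import Literature.NumberTheory.Weil1964.AdelicMetaplecticRationalLiftSum
import Literature.NumberTheory.GelbartRogawski1991.UnitaryDualPairThetaKernel
import HarnessLib

/-!
# Crux H413, E-2 Siegel–Weil sub-line `F0_E2SiegelWeilWeilRange`: the stub SW3 (ONE RATIONAL ORBIT, EQUIVARIANTLY) CLOSED —
# by-name closer for `Cruxes/H413/Lines/F0_E2SiegelWeilWeilRange.lean` (A-p17 (g13) ED. 3c ∕ ED. 4, tree 04e07c34)

HC_CM is proved only modulo the printed citations until rung 0 closes.  Cell `hodgecm-mathlib`, programme P4, engine E-2, child line typed by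
A-p17 (g13); item stmt-HodgeConjecture-24833.  This file states the stub TYPE `StubSW3` of the line file VERBATIM (with the line's in-file
definitions `ratDoubledW`, `stabDiagRat`, `actRat`, `boxConj`, `TWD`, `eD`, `isUnit_det_dGram`, `TWD_isSymm` unfolded to their bodies — a Theorems
file cannot import a Lines file) and proves it from the Literature cores ★ `Automorphic/UnitaryGroupDoubledSiegelOrbit` (the orbit lemma at rank
one), ★ `Automorphic/UnitaryDualPairDoubledLine{Diagonal,Frames,Stabiliser}` (Siegel ⇔ stabilises the diagonal Lagrangian; `ι(1 ⊗ (γ ⊕ 1)) =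
ι(1 ⊗ γ) ⊕ 1`) and ★ `Weil1964/AdelicMetaplecticRationalLiftSum` (`r_F` of a rational direct sum is the external tensor of the `r_F`'s), all by
F0P4-p08 (g2):

* `sw3_orbit : ‹StubSW3›` — for `N > 2` there is `m : U(J_W)(F) → IW` (`γ ↦` a rational symplectic matrix over `ι(1 ⊗ (γ, 1))`) inducing a
  BIJECTION `U(J_W)(F) ≃ IW ⧸ PW` (injective: `(γ₁, 1)⁻¹(γ₂, 1) = (γ₁⁻¹γ₂, 1)` stabilises `V ⊗ W^Δ` only if `γ₁ = γ₂` — ★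
  `rowSum_eq_of_conj_doublingDelta_apply_zero`, `rowSum_reindex_fromBlocks_iff`; surjective: every `w ∈ U(W ⊕ W⁻)(F)` is `(γ, 1) · p` with `p`
  Siegel — ★ `existsUnique_isSiegelReindex_blockDiagFin_inv_mul_of_rank_one` — and Siegel elements stabilise the diagonal, so `δ ι(1 ⊗ p) δ⁻¹ ∈
  P_𝕐` — ★ `isDiag_toSp_doubled_rationalInr`, `conj_doublingDelta_mem_siegelParabolicPi_of_isDiag`, `ratSp_doublingDeltaRat`), and EQUIVARIANT
  on pure tensors: `ω□(r_F^□(m γ))(Φ₁ ⊠ Φ̄₂) = (ω(s(1,γ))Φ₁) ⊠ Φ̄₂` (★ `coe_toSp_doubled_eq_spReindex_spSum`: `r_F^□(m γ)` lies over `ι(1 ⊗ γ) ⊕ 1`;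
  ★ `omega_ratThetaLiftCont_sumTensor_of_ratSp_eq_left`; and `s(1, γ) = r_F` at rational `γ` by compatibility, ★ `IsCompatible.apply_eq_ratSplit`).
  [GelbartPiatetskishapiroRallis1987, Part A §2 Lemma 2.1 pp. 7–9; HarrisKudlaSweet1996, §1 (1.2)–(1.3); Weil1964, Chap. III n° 38, n° 41 Thm 6;
  Li1992, p. 181.]

The fold in the line file is `theorem stub_SW3_orbit : StubSW3 := E2SWOrbit.sw3_orbit` (definitional unfolding of the in-file `def`s).

## References
[GelbartPiatetskishapiroRallis1987] Part A §2 pp. 7–9 · [HarrisKudlaSweet1996] §1 (1.2)–(1.3), (1.11) · [Weil1964] Chap. III n° 37–41 ·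
[Li1992] p. 181 · [Kudla1994] §1.
-/

set_option autoImplicit false

noncomputable section

set_option linter.dupNamespace false

namespace Summit.HodgeConjecture.HodgeConjecture.Cruxes.H413.E2SWOrbit

open scoped Matrix ComplexConjugate Kronecker
open NumberField
open Literature.RepresentationTheory.HeisenbergGroup
open Literature.NumberTheory.Weil1964 Literature.NumberTheory.Automorphic
open Literature.NumberTheory.GelbartRogawski1991 Literature.NumberTheory.GelbartRogawski1991.UnitaryDualPair

/-! ## §0 Abstract group plumbing and the doubled line `T_W ⊕ (−T_W)` -/

/-- `φ a = ψ x`, `φ b = ψ y` ⇒ `φ(a⁻¹b) = ψ(x⁻¹y)` for two homomorphisms into the same group. [folklore] -/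
private theorem map_inv_mul_of_eq {G H K : Type*} [Group G] [Group H] [Group K] (φ : G →* K) (ψ : H →* K)
    {a b : G} {x y : H} (ha : φ a = ψ x) (hb : φ b = ψ y) : φ (a⁻¹ * b) = ψ (x⁻¹ * y) := by
  rw [map_mul, map_inv, map_mul, map_inv, ha, hb]

/-- `φ a = ψ x` ⇒ `φ a⁻¹ = ψ x⁻¹`. [folklore] -/
private theorem map_inv_of_eq {G H K : Type*} [Group G] [Group H] [Group K] (φ : G →* K) (ψ : H →* K)
    {a : G} {x : H} (ha : φ a = ψ x) : φ a⁻¹ = ψ x⁻¹ := by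
  rw [map_inv, map_inv, ha]

/-- `φ (d z d⁻¹) = φ d · φ z · (φ d)⁻¹`. [folklore] -/
private theorem map_conj_eq {G K : Type*} [Group G] [Group K] (φ : G →* K) (d z : G) :
    φ (d * z * d⁻¹) = φ d * φ z * (φ d)⁻¹ := by
  rw [map_mul, map_mul, map_inv]

/-- membership in the `δ`-conjugated pull-back: `z ∈ (P.comap f).comap (conj d) ↔ f d · f z · (f d)⁻¹ ∈ P`. [folklore] -/
private theorem mem_conj_comap_iff {G K : Type*} [Group G] [Group K] (f : G →* K) (P : Subgroup K) (d z : G) :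
    z ∈ (P.comap f).comap (MulAut.conj d).toMonoidHom ↔ f d * f z * (f d)⁻¹ ∈ P := by
  simp only [Subgroup.mem_comap, MulEquiv.coe_toMonoidHom, MulAut.conj_apply, map_mul, map_inv]

/-- the same for `x⁻¹h` with `x, h` in a subgroup `H`. [folklore] -/
private theorem coe_inv_mul_mem_comap_conj_iff {G K : Type*} [Group G] [Group K] (f : G →* K) (P : Subgroup K) (d : G)
    (H : Subgroup G) (x h : H) :
    ((x⁻¹ * h : H) : G) ∈ (P.comap f).comap (MulAut.conj d).toMonoidHom ↔ f d * f ((x : G)⁻¹ * (h : G)) * (f d)⁻¹ ∈ P := by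
  rw [Subgroup.mem_comap, Subgroup.mem_comap, MulEquiv.coe_toMonoidHom, MulAut.conj_apply, map_mul, map_mul, map_inv,
    Subgroup.coe_mul, InvMemClass.coe_inv]

section Box

variable (F : Type) [Field F] [NumberField F] {n : ℕ} (T : Matrix (Fin n) (Fin n) (AdeleRing (𝓞 F) F)) (hT : IsUnit T.det)

include hT in
/-- ★ `omega_ratThetaLiftCont_sumTensor_of_ratSp_eq_left` read on `Φ₁ ⊠ Φ̄₂ = piSBReindex (Φ₁ ⊗ conj Φ₂)` (the line's `boxConj`).
[cite: Weil1964, Chap. III n° 38 pp. 189–190 and n° 41 Thm 6 p. 193] -/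
theorem omega_ratThetaLiftCont_boxConj (x : Matrix.symplecticGroup (Fin (n + n)) F) (x₁ : Matrix.symplecticGroup (Fin n) F)
    (hx : ratSp F (doubledGramFin F T) (isUnit_det_doubledGramFin F T hT) x =
      UnitaryGroup.spReindex finSumFinEquiv (Matrix.fromBlocks T 0 0 (-T)) (UnitaryGroup.spSum T (-T) (ratSp F T hT x₁, 1)))
    (Φ₁ Φ₂ : piSchwartzBruhat F (Fin n)) :
    adelicMpCont.omega F (Fin (n + n)) (doubledGramFin F T)
        (ratThetaLiftCont F (doubledGramFin F T) (isUnit_det_doubledGramFin F T hT) x)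
        (piSBReindex F finSumFinEquiv (tensorToSum F (Fin n) (Fin n) Φ₁ (piSchwartzBruhatConj F (Fin n) Φ₂))) =
      piSBReindex F finSumFinEquiv (tensorToSum F (Fin n) (Fin n)
        (adelicMpCont.omega F (Fin n) T (ratThetaLiftCont F T hT x₁) Φ₁) (piSchwartzBruhatConj F (Fin n) Φ₂)) := by
  exact (congrArg (fun t => adelicMpCont.omega F (Fin (n + n)) (doubledGramFin F T)
      (ratThetaLiftCont F (doubledGramFin F T) (isUnit_det_doubledGramFin F T hT) x) t)
    (sumTensor_finSumFinEquiv_symm F Φ₁ (piSchwartzBruhatConj F (Fin n) Φ₂))).symm.trans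
    ((omega_ratThetaLiftCont_sumTensor_of_ratSp_eq_left F T hT x x₁ hx Φ₁ (piSchwartzBruhatConj F (Fin n) Φ₂)).trans
      (sumTensor_finSumFinEquiv_symm F _ _))

end Box

section TWD

variable (F E : Type) [Field F] [Field E] [Algebra F E] (TW : Matrix (Fin 1) (Fin 1) F)

/-- `T_W ⊕ (−T_W)` is symmetric (the line's `TWD_isSymm`). [cite: GelbartPiatetskishapiroRallis1987, Part A §2 pp. 7–9] -/
theorem twd_isSymm (hW : TW.IsSymm) : (Matrix.reindex finSumFinEquiv finSumFinEquiv (Matrix.fromBlocks TW 0 0 (-TW))).IsSymm := by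
  rw [Matrix.IsSymm, Matrix.reindex_apply, Matrix.transpose_submatrix, Matrix.fromBlocks_transpose, Matrix.transpose_neg, hW.eq]
  simp

/-- `(T_W ⊕ (−T_W)) ⊗ 1 = (T_W ⊗ 1) ⊕ᶠ (−(T_W ⊗ 1))` over `E`. [cite: GelbartPiatetskishapiroRallis1987, Part A §2 pp. 7–9] -/
theorem twd_map : (Matrix.reindex finSumFinEquiv finSumFinEquiv (Matrix.fromBlocks TW 0 0 (-TW))).map (algebraMap F E) = UnitaryGroup.finSum 1 1 (TW.map (algebraMap F E)) (-(TW.map (algebraMap F E))) := by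
  ext i j
  obtain ⟨x, rfl⟩ := finSumFinEquiv.surjective i
  obtain ⟨y, rfl⟩ := finSumFinEquiv.surjective j
  rcases x with x | x <;> rcases y with y | y <;>
    simp [UnitaryGroup.finSum, -finSumFinEquiv_apply_right, -finSumFinEquiv_apply_left]

/-- `det (T_W ⊕ (−T_W))` is a unit when `det T_W` is. [cite: GelbartPiatetskishapiroRallis1987, Part A §2 pp. 7–9] -/
theorem twd_det (hWd : IsUnit TW.det) : IsUnit (Matrix.reindex finSumFinEquiv finSumFinEquiv (Matrix.fromBlocks TW 0 0 (-TW))).det := by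
  rw [Matrix.det_reindex_self, Matrix.det_fromBlocks_zero₂₁, Matrix.det_neg]
  exact hWd.mul (((isUnit_one.neg).pow _).mul hWd)

end TWD

section Gram

variable (F : Type) [Field F] [NumberField F] (N : ℕ) {n : ℕ} (e : Fin N × Fin 1 ≃ Fin n)
  (TV : Matrix (Fin N) (Fin N) F) (TW : Matrix (Fin 1) (Fin 1) F)

/-- **`adelicGram (eD) T_V (T_W ⊕ −T_W) = 𝕋`** (the line's `adelicGram_eD_eq_doubledGramFin`): in the doubled enumeration `eD` the adelic Gram
matrix of the DOUBLED PAIR IS the doubled Gram matrix `(T ⊗ 1) ⊕ (−T ⊗ 1)` of the `Weil1964` doubling files.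
[cite: GelbartPiatetskishapiroRallis1987, Part A §2 pp. 7–9] -/
theorem adelicGram_eD_eq : adelicGram F (((Equiv.prodCongr (Equiv.refl (Fin N)) finSumFinEquiv.symm).trans (Equiv.prodSumDistrib (Fin N) (Fin 1) (Fin 1))).trans ((Equiv.sumCongr e e).trans finSumFinEquiv)) TV (Matrix.reindex finSumFinEquiv finSumFinEquiv (Matrix.fromBlocks TW 0 0 (-TW))) = doubledGramFin F (adelicGram F e TV TW) := by
  rw [adelicGram_eq_map, adelicGram_eq_map, doubledGramFin_eq]
  ext i j
  obtain ⟨x, rfl⟩ := finSumFinEquiv.surjective i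
  obtain ⟨y, rfl⟩ := finSumFinEquiv.surjective j
  rcases x with i' | i' <;> rcases y with j' | j' <;>
    obtain ⟨⟨a, b⟩, rfl⟩ := e.surjective i' <;> obtain ⟨⟨a', b'⟩, rfl⟩ := e.surjective j' <;>
    simp [Matrix.kroneckerMap_apply, -finSumFinEquiv_apply_right, -finSumFinEquiv_apply_left]

end Gram

/-! ## §1 SW3 -/

-- one step (`map_one`∕`one_mul` on `U(J_V ⊗ J_W)(𝔸)`, the `(1, γ)` of the stub's letter) unifies instance paths on the adelic
-- unitary carriers and needs ≈ 3× the default heartbeat budget; everything else elaborates within the default.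
set_option maxHeartbeats 800000 in
/-- **SW3 — ONE RATIONAL ORBIT, EQUIVARIANTLY** (the line's `StubSW3`, verbatim with `ratDoubledW`∕`stabDiagRat`∕`actRat`∕`boxConj`∕`TWD`∕`eD`
unfolded): for `N > 2` there is `m : U(J_W)(F) → IW` (`γ ↦ ι(1 ⊗ (γ, 1))`) inducing a BIJECTION `U(J_W)(F) ≃ IW ⧸ PW` — one rational orbit with
diagonal stabiliser (rank one ⇒ `W` anisotropic) — EQUIVARIANT on pure tensors at rational points: `ω□(r_F^□(m γ))(Φ₁ ⊠ Φ̄₂) = (ω(γ)Φ₁) ⊠ Φ̄₂`.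
[cite: GelbartPiatetskishapiroRallis1987, Part A §2 Lemma 2.1 pp. 7–9] [cite: HarrisKudlaSweet1996, §1 (1.2)–(1.3)]
[cite: Weil1964, Chap. III n° 41 Thm 6 p. 193] -/
theorem sw3_orbit :
  ∀ (F E : Type) [Field F] [NumberField F] [Field E] [NumberField E] [Algebra F E]
    (c : E ≃ₐ[F] E) (N : ℕ) {n : ℕ} (e : Fin N × Fin 1 ≃ Fin n)
    {TV : Matrix (Fin N) (Fin N) F} {TW : Matrix (Fin 1) (Fin 1) F}
    [Algebra.IsQuadraticExtension F E] {δ : E} (hcδ : c δ = -δ) (hδ : δ ≠ 0) {d : F}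
    (hd : δ * δ = algebraMap F E d) (hV : TV.IsSymm) (hW : TW.IsSymm) (hVd : IsUnit TV.det) (hWd : IsUnit TW.det)
    [LocallyCompactSpace (UnitaryGroup.adelic F E c N (TV.map (algebraMap F E)))]
    [LocallyCompactSpace (UnitaryGroup.adelic F E c 1 (TW.map (algebraMap F E)))]
    (s : UnitaryGroup.adelicPair F E c N 1 (TV.map (algebraMap F E)) (TW.map (algebraMap F E)) →*
      adelicMpCont F (Fin n) (adelicGram F e TV TW))
    (hs : (splittingDatum F E c N 1 e (TV.map (algebraMap F E)) (TW.map (algebraMap F E)) hcδ hδ hd hV hW hVd hWd rfl rfl).IsCompatible s),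
    2 < N →
    ∃ m : (UnitaryGroup.toAdelic F E c 1 (TW.map (algebraMap F E))).range → ((((symplecticGroup (polar (adelicForm F (Fin (n + n)) (adelicGram F (((Equiv.prodCongr (Equiv.refl (Fin N)) finSumFinEquiv.symm).trans (Equiv.prodSumDistrib (Fin N) (Fin 1) (Fin 1))).trans ((Equiv.sumCongr e e).trans finSumFinEquiv)) TV (Matrix.reindex finSumFinEquiv finSumFinEquiv (Matrix.fromBlocks TW 0 0 (-TW))))))).subtype.comp ((toSp F E c N (1 + 1) (((Equiv.prodCongr (Equiv.refl (Fin N)) finSumFinEquiv.symm).trans (Equiv.prodSumDistrib (Fin N) (Fin 1) (Fin 1))).trans ((Equiv.sumCongr e e).trans finSumFinEquiv)) (TV.map (algebraMap F E)) ((Matrix.reindex finSumFinEquiv finSumFinEquiv (Matrix.fromBlocks TW 0 0 (-TW))).map (algebraMap F E)) hcδ hδ hd hV (twd_isSymm F TW hW) rfl rfl).comp ((UnitaryGroup.adelicInr F E c N (1 + 1) (TV.map (algebraMap F E)) ((Matrix.reindex finSumFinEquiv finSumFinEquiv (Matrix.fromBlocks TW 0 0 (-TW))).map (algebraMap F E))).comp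 (UnitaryGroup.toAdelic F E c (1 + 1) ((Matrix.reindex finSumFinEquiv finSumFinEquiv (Matrix.fromBlocks TW 0 0 (-TW))).map (algebraMap F E)))))).range).comap ((symplecticGroup (polar (adelicForm F (Fin (n + n)) (doubledGramFin F (adelicGram F e TV TW))))).subtype.comp (ratSp F (doubledGramFin F (adelicGram F e TV TW)) (isUnit_det_doubledGramFin F _ (isUnit_det_adelicGram F e hVd hWd))))),
      Function.Bijective (fun γ =>
        (QuotientGroup.mk (m γ) : ((((symplecticGroup (polar (adelicForm F (Fin (n + n)) (adelicGram F (((Equiv.prodCongr (Equiv.refl (Fin N)) finSumFinEquiv.symm).trans (Equiv.prodSumDistrib (Fin N) (Fin 1) (Fin 1))).trans ((Equiv.sumCongr e e).trans finSumFinEquiv)) TV (Matrix.reindex finSumFinEquiv finSumFinEquiv (Matrix.fromBlocks TW 0 0 (-TW))))))).subtype.comp ((toSp F E c N (1 + 1) (((Equiv.prodCongr (Equiv.refl (Fin N)) finSumFinEquiv.symm).trans (Equiv.prodSumDistrib (Fin N) (Fin 1) (Fin 1))).trans ((Equiv.sumCongr e e).trans finSumFinEquiv)) (TV.map (algebraMap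 F E)) ((Matrix.reindex finSumFinEquiv finSumFinEquiv (Matrix.fromBlocks TW 0 0 (-TW))).map (algebraMap F E)) hcδ hδ hd hV (twd_isSymm F TW hW) rfl rfl).comp ((UnitaryGroup.adelicInr F E c N (1 + 1) (TV.map (algebraMap F E)) ((Matrix.reindex finSumFinEquiv finSumFinEquiv (Matrix.fromBlocks TW 0 0 (-TW))).map (algebraMap F E))).comp (UnitaryGroup.toAdelic F E c (1 + 1) ((Matrix.reindex finSumFinEquiv finSumFinEquiv (Matrix.fromBlocks TW 0 0 (-TW))).map (algebraMap F E)))))).range).comap ((symplecticGroup (polar (adelicForm F (Fin (n + n)) (doubledGramFin F (adelicGram F e TV TW))))).subtype.comp (ratSp F (doubledGramFin F (adelicGram F e TV TW)) (isUnit_det_doubledGramFin F _ (isUnit_det_adelicGram F e hVd hWd))))) ⧸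
          (((siegelParabolicPi (doubledGramFin F (adelicGram F e TV TW))).comap (ratSp F (doubledGramFin F (adelicGram F e TV TW)) (isUnit_det_doubledGramFin F _ (isUnit_det_adelicGram F e hVd hWd)))).comap (MulAut.conj (doublingDeltaRat F (n := n))).toMonoidHom).subgroupOf ((((symplecticGroup (polar (adelicForm F (Fin (n + n)) (adelicGram F (((Equiv.prodCongr (Equiv.refl (Fin N)) finSumFinEquiv.symm).trans (Equiv.prodSumDistrib (Fin N) (Fin 1) (Fin 1))).trans ((Equiv.sumCongr e e).trans finSumFinEquiv)) TV (Matrix.reindex finSumFinEquiv finSumFinEquiv (Matrix.fromBlocks TW 0 0 (-TW))))))).subtype.comp ((toSp F E c N (1 + 1) (((Equiv.prodCongr (Equiv.refl (Fin N)) finSumFinEquiv.symm).trans (Equiv.prodSumDistrib (Fin N) (Fin 1) (Fin 1))).trans ((Equiv.sumCongr e e).trans finSumFinEquiv)) (TV.map (algebraMap F E)) ((Matrix.reindex finSumFinEquiv finSumFinEquiv (Matrix.fromBlocks TW 0 0 (-TW))).map (algebraMap F E)) hcδ hδ hd hV (twd_isSymm F TW hW) rfl rfl).comp ((UnitaryGroup.adelicInr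 F E c N (1 + 1) (TV.map (algebraMap F E)) ((Matrix.reindex finSumFinEquiv finSumFinEquiv (Matrix.fromBlocks TW 0 0 (-TW))).map (algebraMap F E))).comp (UnitaryGroup.toAdelic F E c (1 + 1) ((Matrix.reindex finSumFinEquiv finSumFinEquiv (Matrix.fromBlocks TW 0 0 (-TW))).map (algebraMap F E)))))).range).comap ((symplecticGroup (polar (adelicForm F (Fin (n + n)) (doubledGramFin F (adelicGram F e TV TW))))).subtype.comp (ratSp F (doubledGramFin F (adelicGram F e TV TW)) (isUnit_det_doubledGramFin F _ (isUnit_det_adelicGram F e hVd hWd))))))) ∧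
      ∀ (γ : (UnitaryGroup.toAdelic F E c 1 (TW.map (algebraMap F E))).range) (Φ₁ Φ₂ : piSchwartzBruhat F (Fin n)),
        adelicMpCont.omega F (Fin (n + n)) (doubledGramFin F (adelicGram F e TV TW)) (ratThetaLiftCont F (doubledGramFin F (adelicGram F e TV TW)) (isUnit_det_doubledGramFin F _ (isUnit_det_adelicGram F e hVd hWd)) (m γ : Matrix.symplecticGroup (Fin (n + n)) F)) (piSBReindex F finSumFinEquiv (tensorToSum F (Fin n) (Fin n) Φ₁ (piSchwartzBruhatConj F (Fin n) Φ₂))) =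
          (piSBReindex F finSumFinEquiv (tensorToSum F (Fin n) (Fin n) ((pairRep F E c N 1 e (TV.map (algebraMap F E)) (TW.map (algebraMap F E)) s) (1, (γ : UnitaryGroup.adelic F E c 1 (TW.map (algebraMap F E)))) Φ₁) (piSchwartzBruhatConj F (Fin n) Φ₂))) := by
  intro F E _ _ _ _ _ c N n e TV TW _ δ hcδ hδ d hd hV hW hVd hWd _ _ s hs hN
  -- the Gram identity, the doubled line and its rational points
  have hTT : adelicGram F (((Equiv.prodCongr (Equiv.refl (Fin N)) finSumFinEquiv.symm).trans (Equiv.prodSumDistrib (Fin N) (Fin 1) (Fin 1))).trans ((Equiv.sumCongr e e).trans finSumFinEquiv)) TV (Matrix.reindex finSumFinEquiv finSumFinEquiv (Matrix.fromBlocks TW 0 0 (-TW))) = (doubledGramFin F (adelicGram F e TV TW)) := adelicGram_eD_eq F N e TV TW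
  have hWD : IsUnit (Matrix.reindex finSumFinEquiv finSumFinEquiv (Matrix.fromBlocks TW 0 0 (-TW))).det := twd_det F TW hWd
  have hUeq : UnitaryGroup.rational F E c (1 + 1) ((Matrix.reindex finSumFinEquiv finSumFinEquiv (Matrix.fromBlocks TW 0 0 (-TW))).map (algebraMap F E)) = unitaryGroupOfForm (c : E →+* E) (UnitaryGroup.finSum 1 1 (TW.map (algebraMap F E)) (-(TW.map (algebraMap F E)))) :=
    congrArg (unitaryGroupOfForm (c : E →+* E)) (twd_map F E TW)
  have hSu : IsUnit (TW.map (algebraMap F E)).det := by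
    rw [← (algebraMap F E).mapMatrix_apply, ← RingHom.map_det]
    exact hWd.map _
  -- rational preimages `γF γ` of the elements of `Γ = U(J_W)(F) ≤ U(J_W)(𝔸)`
  have hpre : ∀ γ : (UnitaryGroup.toAdelic F E c 1 (TW.map (algebraMap F E))).range, ∃ g : UnitaryGroup.rational F E c 1 (TW.map (algebraMap F E)), UnitaryGroup.toAdelic F E c 1 (TW.map (algebraMap F E)) g = γ :=
    fun γ => γ.2
  choose γF hγF using hpre
  -- the doubled rational element `w γ = (γF γ, 1)` of `U(T_W ⊕ −T_W)(F)`
  have hwd : ∀ γ : (UnitaryGroup.toAdelic F E c 1 (TW.map (algebraMap F E))).range, ∃ w : UnitaryGroup.rational F E c (1 + 1) ((Matrix.reindex finSumFinEquiv finSumFinEquiv (Matrix.fromBlocks TW 0 0 (-TW))).map (algebraMap F E)),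
      (w : GL (Fin (1 + 1)) E) = (((UnitaryGroup.blockDiagFin (c : E →+* E) (TW.map (algebraMap F E)) (-(TW.map (algebraMap F E)))) (γF γ, 1) : unitaryGroupOfForm (c : E →+* E) (UnitaryGroup.finSum 1 1 (TW.map (algebraMap F E)) (-(TW.map (algebraMap F E))))) : GL (Fin (1 + 1)) E) :=
    fun γ => ⟨⟨_, (SetLike.ext_iff.1 hUeq _).2 ((UnitaryGroup.blockDiagFin (c : E →+* E) (TW.map (algebraMap F E)) (-(TW.map (algebraMap F E)))) (γF γ, 1)).2⟩, rfl⟩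
  choose w hw using hwd
  have hwM : ∀ γ : (UnitaryGroup.toAdelic F E c 1 (TW.map (algebraMap F E))).range, ((w γ : GL (Fin (1 + 1)) E) : Matrix (Fin (1 + 1)) (Fin (1 + 1)) E) =
      Matrix.reindex finSumFinEquiv finSumFinEquiv
        (Matrix.fromBlocks ((γF γ : GL (Fin 1) E) : Matrix (Fin 1) (Fin 1) E) 0 0 (1 : Matrix (Fin 1) (Fin 1) E)) := fun γ => by
    rw [hw γ, UnitaryGroup.coe_blockDiagFin]
    rfl
  -- the rational symplectic matrix `m γ` over `ι(1 ⊗ w γ)`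
  have hm' : ∀ γ : (UnitaryGroup.toAdelic F E c 1 (TW.map (algebraMap F E))).range, ∃ x : Matrix.symplecticGroup (Fin (n + n)) F,
      ((ratSp F (doubledGramFin F (adelicGram F e TV TW)) (isUnit_det_doubledGramFin F _ (isUnit_det_adelicGram F e hVd hWd)) x : (symplecticGroup (polar (adelicForm F (Fin (n + n)) (doubledGramFin F (adelicGram F e TV TW)))))) : (((Fin (n + n) → AdeleRing (𝓞 F) F) × (Fin (n + n) → AdeleRing (𝓞 F) F)) ≃ₗ[AdeleRing (𝓞 F) F] ((Fin (n + n) → AdeleRing (𝓞 F) F) × (Fin (n + n) → AdeleRing (𝓞 F) F)))) =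
        (((toSp F E c N (1 + 1) (((Equiv.prodCongr (Equiv.refl (Fin N)) finSumFinEquiv.symm).trans (Equiv.prodSumDistrib (Fin N) (Fin 1) (Fin 1))).trans ((Equiv.sumCongr e e).trans finSumFinEquiv)) (TV.map (algebraMap F E)) ((Matrix.reindex finSumFinEquiv finSumFinEquiv (Matrix.fromBlocks TW 0 0 (-TW))).map (algebraMap F E)) hcδ hδ hd hV (twd_isSymm F TW hW) rfl rfl) (UnitaryGroup.adelicInr F E c N (1 + 1) (TV.map (algebraMap F E)) ((Matrix.reindex finSumFinEquiv finSumFinEquiv (Matrix.fromBlocks TW 0 0 (-TW))).map (algebraMap F E)) (UnitaryGroup.toAdelic F E c (1 + 1) ((Matrix.reindex finSumFinEquiv finSumFinEquiv (Matrix.fromBlocks TW 0 0 (-TW))).map (algebraMap F E)) (w γ))) : (symplecticGroup (polar (adelicForm F (Fin (n + n)) (adelicGram F (((Equiv.prodCongr (Equiv.refl (Fin N)) finSumFinEquiv.symm).trans (Equiv.prodSumDistrib (Fin N) (Fin 1) (Fin 1))).trans ((Equiv.sumCongr e e).trans finSumFinEquiv)) TV (Matrix.reindex finSumFinEquiv finSumFinEquiv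 (Matrix.fromBlocks TW 0 0 (-TW)))))))) : (((Fin (n + n) → AdeleRing (𝓞 F) F) × (Fin (n + n) → AdeleRing (𝓞 F) F)) ≃ₗ[AdeleRing (𝓞 F) F] ((Fin (n + n) → AdeleRing (𝓞 F) F) × (Fin (n + n) → AdeleRing (𝓞 F) F)))) :=
    fun γ => UnitaryGroup.exists_ratSp_coe_eq_toSp F E c hcδ hδ hd N (1 + 1) (((Equiv.prodCongr (Equiv.refl (Fin N)) finSumFinEquiv.symm).trans (Equiv.prodSumDistrib (Fin N) (Fin 1) (Fin 1))).trans ((Equiv.sumCongr e e).trans finSumFinEquiv)) hV (twd_isSymm F TW hW) hVd hWD (doubledGramFin F (adelicGram F e TV TW)) (isUnit_det_doubledGramFin F _ (isUnit_det_adelicGram F e hVd hWd)) hTT (w γ)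
  choose m hm using hm'
  have hmw : ∀ γ : (UnitaryGroup.toAdelic F E c 1 (TW.map (algebraMap F E))).range, ∃ y : ((((symplecticGroup (polar (adelicForm F (Fin (n + n)) (adelicGram F (((Equiv.prodCongr (Equiv.refl (Fin N)) finSumFinEquiv.symm).trans (Equiv.prodSumDistrib (Fin N) (Fin 1) (Fin 1))).trans ((Equiv.sumCongr e e).trans finSumFinEquiv)) TV (Matrix.reindex finSumFinEquiv finSumFinEquiv (Matrix.fromBlocks TW 0 0 (-TW))))))).subtype.comp ((toSp F E c N (1 + 1) (((Equiv.prodCongr (Equiv.refl (Fin N)) finSumFinEquiv.symm).trans (Equiv.prodSumDistrib (Fin N) (Fin 1) (Fin 1))).trans ((Equiv.sumCongr e e).trans finSumFinEquiv)) (TV.map (algebraMap F E)) ((Matrix.reindex finSumFinEquiv finSumFinEquiv (Matrix.fromBlocks TW 0 0 (-TW))).map (algebraMap F E)) hcδ hδ hd hV (twd_isSymm F TW hW) rfl rfl).comp ((UnitaryGroup.adelicInr F E c N (1 + 1) (TV.map (algebraMap F E)) ((Matrix.reindex finSumFinEquiv finSumFinEquiv (Matrix.fromBlocks TW 0 0 (-TW))).map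 (algebraMap F E))).comp (UnitaryGroup.toAdelic F E c (1 + 1) ((Matrix.reindex finSumFinEquiv finSumFinEquiv (Matrix.fromBlocks TW 0 0 (-TW))).map (algebraMap F E)))))).range).comap ((symplecticGroup (polar (adelicForm F (Fin (n + n)) (doubledGramFin F (adelicGram F e TV TW))))).subtype.comp (ratSp F (doubledGramFin F (adelicGram F e TV TW)) (isUnit_det_doubledGramFin F _ (isUnit_det_adelicGram F e hVd hWd))))), (y : Matrix.symplecticGroup (Fin (n + n)) F) = m γ :=
    fun γ => ⟨⟨m γ, Subgroup.mem_comap.2 (MonoidHom.mem_range.2 ⟨w γ, (hm γ).symm⟩)⟩, rfl⟩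
  choose mW hmW using hmw
  refine ⟨mW, ⟨fun γ₁ γ₂ hq => ?_, fun q => ?_⟩, fun γ Φ₁ Φ₂ => ?_⟩
  · -- INJECTIVE: `(γ₁, 1)⁻¹ (γ₂, 1) = (γ₁⁻¹ γ₂, 1)` stabilises `V ⊗ W^Δ` only if `γ₁ = γ₂`
    have hmem := QuotientGroup.eq.1 hq
    rw [Subgroup.mem_subgroupOf] at hmem
    have hP0 := (coe_inv_mul_mem_comap_conj_iff (ratSp F (doubledGramFin F (adelicGram F e TV TW)) (isUnit_det_doubledGramFin F _ (isUnit_det_adelicGram F e hVd hWd))) (siegelParabolicPi (doubledGramFin F (adelicGram F e TV TW))) (doublingDeltaRat F) _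
      (mW γ₁) (mW γ₂)).1 hmem
    rw [hmW, hmW] at hP0
    have hconj : (ratSp F (doubledGramFin F (adelicGram F e TV TW)) (isUnit_det_doubledGramFin F _ (isUnit_det_adelicGram F e hVd hWd)) (doublingDeltaRat F)) * (ratSp F (doubledGramFin F (adelicGram F e TV TW)) (isUnit_det_doubledGramFin F _ (isUnit_det_adelicGram F e hVd hWd)) ((m γ₁)⁻¹ * m γ₂)) * ((ratSp F (doubledGramFin F (adelicGram F e TV TW)) (isUnit_det_doubledGramFin F _ (isUnit_det_adelicGram F e hVd hWd)) (doublingDeltaRat F)))⁻¹ = (UnitaryGroup.spReindex finSumFinEquiv (Matrix.fromBlocks (adelicGram F e TV TW) 0 0 (-(adelicGram F e TV TW))) (doublingDelta (adelicGram F e TV TW) (isUnit_det_adelicGram F e hVd hWd))) * (ratSp F (doubledGramFin F (adelicGram F e TV TW)) (isUnit_det_doubledGramFin F _ (isUnit_det_adelicGram F e hVd hWd)) ((m γ₁)⁻¹ * m γ₂)) * ((UnitaryGroup.spReindex finSumFinEquiv (Matrix.fromBlocks (adelicGram F e TV TW) 0 0 (-(adelicGram F e TV TW))) (doublingDelta (adelicGram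 F e TV TW) (isUnit_det_adelicGram F e hVd hWd))))⁻¹ := by
      rw [ratSp_doublingDeltaRat F (adelicGram F e TV TW) (isUnit_det_adelicGram F e hVd hWd)]
    rw [hconj] at hP0
    have hP : ∀ y : Fin (n + n) → AdeleRing (𝓞 F) F,
        ((((UnitaryGroup.spReindex finSumFinEquiv (Matrix.fromBlocks (adelicGram F e TV TW) 0 0 (-(adelicGram F e TV TW))) (doublingDelta (adelicGram F e TV TW) (isUnit_det_adelicGram F e hVd hWd))) * (ratSp F (doubledGramFin F (adelicGram F e TV TW)) (isUnit_det_doubledGramFin F _ (isUnit_det_adelicGram F e hVd hWd)) ((m γ₁)⁻¹ * m γ₂)) * ((UnitaryGroup.spReindex finSumFinEquiv (Matrix.fromBlocks (adelicGram F e TV TW) 0 0 (-(adelicGram F e TV TW))) (doublingDelta (adelicGram F e TV TW) (isUnit_det_adelicGram F e hVd hWd))))⁻¹ : (symplecticGroup (polar (adelicForm F (Fin (n + n)) (doubledGramFin F (adelicGram F e TV TW)))))) : (((Fin (n + n) → AdeleRing (𝓞 F) F) × (Fin (n + n) → AdeleRing (𝓞 F) F)) ≃ₗ[AdeleRing (𝓞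 F) F] ((Fin (n + n) → AdeleRing (𝓞 F) F) × (Fin (n + n) → AdeleRing (𝓞 F) F)))) (0, y)).1 = 0 := hP0.1
    have hXw := map_inv_mul_of_eq ((symplecticGroup (polar (adelicForm F (Fin (n + n)) (doubledGramFin F (adelicGram F e TV TW))))).subtype.comp (ratSp F (doubledGramFin F (adelicGram F e TV TW)) (isUnit_det_doubledGramFin F _ (isUnit_det_adelicGram F e hVd hWd)))) ((symplecticGroup (polar (adelicForm F (Fin (n + n)) (adelicGram F (((Equiv.prodCongr (Equiv.refl (Fin N)) finSumFinEquiv.symm).trans (Equiv.prodSumDistrib (Fin N) (Fin 1) (Fin 1))).trans ((Equiv.sumCongr e e).trans finSumFinEquiv)) TV (Matrix.reindex finSumFinEquiv finSumFinEquiv (Matrix.fromBlocks TW 0 0 (-TW))))))).subtype.comp ((toSp F E c N (1 + 1) (((Equiv.prodCongr (Equiv.refl (Fin N)) finSumFinEquiv.symm).trans (Equiv.prodSumDistrib (Fin N) (Fin 1) (Fin 1))).trans ((Equiv.sumCongr e e).trans finSumFinEquiv)) (TV.map (algebraMap F E)) ((Matrix.reindex finSumFinEquiv finSumFinEquiv (Matrix.fromBlocks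 TW 0 0 (-TW))).map (algebraMap F E)) hcδ hδ hd hV (twd_isSymm F TW hW) rfl rfl).comp ((UnitaryGroup.adelicInr F E c N (1 + 1) (TV.map (algebraMap F E)) ((Matrix.reindex finSumFinEquiv finSumFinEquiv (Matrix.fromBlocks TW 0 0 (-TW))).map (algebraMap F E))).comp (UnitaryGroup.toAdelic F E c (1 + 1) ((Matrix.reindex finSumFinEquiv finSumFinEquiv (Matrix.fromBlocks TW 0 0 (-TW))).map (algebraMap F E)))))) (hm γ₁) (hm γ₂)
    have hrow := UnitaryGroup.rowSum_eq_of_conj_doublingDelta_apply_zero F E c hcδ hδ hd N e hV (twd_isSymm F TW hW) (adelicGram F e TV TW) (isUnit_det_adelicGram F e hVd hWd)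
      ⟨0, by omega⟩ ((w γ₁)⁻¹ * w γ₂) (ratSp F (doubledGramFin F (adelicGram F e TV TW)) (isUnit_det_doubledGramFin F _ (isUnit_det_adelicGram F e hVd hWd)) ((m γ₁)⁻¹ * m γ₂)) hXw hP
    have hw12 : (((w γ₁)⁻¹ * w γ₂ : UnitaryGroup.rational F E c (1 + 1) ((Matrix.reindex finSumFinEquiv finSumFinEquiv (Matrix.fromBlocks TW 0 0 (-TW))).map (algebraMap F E))) : GL (Fin (1 + 1)) E) =
        (((UnitaryGroup.blockDiagFin (c : E →+* E) (TW.map (algebraMap F E)) (-(TW.map (algebraMap F E)))) ((γF γ₁)⁻¹ * γF γ₂, 1) : unitaryGroupOfForm (c : E →+* E) (UnitaryGroup.finSum 1 1 (TW.map (algebraMap F E)) (-(TW.map (algebraMap F E))))) : GL (Fin (1 + 1)) E) :=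
      map_inv_mul_of_eq (UnitaryGroup.rational F E c (1 + 1) ((Matrix.reindex finSumFinEquiv finSumFinEquiv (Matrix.fromBlocks TW 0 0 (-TW))).map (algebraMap F E))).subtype
        ((unitaryGroupOfForm (c : E →+* E) (UnitaryGroup.finSum 1 1 (TW.map (algebraMap F E)) (-(TW.map (algebraMap F E))))).subtype.comp ((UnitaryGroup.blockDiagFin (c : E →+* E) (TW.map (algebraMap F E)) (-(TW.map (algebraMap F E)))).comp (MonoidHom.inl _ _))) (hw γ₁) (hw γ₂)
    have hw12M : ((((w γ₁)⁻¹ * w γ₂ : UnitaryGroup.rational F E c (1 + 1) ((Matrix.reindex finSumFinEquiv finSumFinEquiv (Matrix.fromBlocks TW 0 0 (-TW))).map (algebraMap F E))) : GL (Fin (1 + 1)) E) :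
        Matrix (Fin (1 + 1)) (Fin (1 + 1)) E) =
        Matrix.reindex finSumFinEquiv finSumFinEquiv (Matrix.fromBlocks
          ((((γF γ₁)⁻¹ * γF γ₂ : UnitaryGroup.rational F E c 1 (TW.map (algebraMap F E))) : GL (Fin 1) E) : Matrix (Fin 1) (Fin 1) E) 0 0
          (((1 : GL (Fin 1) E)) : Matrix (Fin 1) (Fin 1) E)) := by
      rw [hw12, UnitaryGroup.coe_blockDiagFin]
      rfl
    have h1 := (UnitaryGroup.rowSum_reindex_fromBlocks_iff _ 1 _ hw12M).1 hrow
    have h2 : (γF γ₁)⁻¹ * γF γ₂ = 1 := Subtype.ext h1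
    have h3 : γF γ₁ = γF γ₂ := inv_mul_eq_one.1 h2
    exact Subtype.ext (((hγF γ₁).symm.trans (congrArg (UnitaryGroup.toAdelic F E c 1 (TW.map (algebraMap F E))) h3)).trans (hγF γ₂))
  · -- SURJECTIVE: every `w ∈ U(W ⊕ W⁻)(F)` is `(γ₀, 1) · p` with `p` Siegel, and Siegel elements stabilise the diagonal
    refine (QuotientGroup.mk_surjective q).elim fun h hq => ?_
    refine (show ∃ wh : UnitaryGroup.rational F E c (1 + 1) ((Matrix.reindex finSumFinEquiv finSumFinEquiv (Matrix.fromBlocks TW 0 0 (-TW))).map (algebraMap F E)),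
        ((symplecticGroup (polar (adelicForm F (Fin (n + n)) (adelicGram F (((Equiv.prodCongr (Equiv.refl (Fin N)) finSumFinEquiv.symm).trans (Equiv.prodSumDistrib (Fin N) (Fin 1) (Fin 1))).trans ((Equiv.sumCongr e e).trans finSumFinEquiv)) TV (Matrix.reindex finSumFinEquiv finSumFinEquiv (Matrix.fromBlocks TW 0 0 (-TW))))))).subtype.comp ((toSp F E c N (1 + 1) (((Equiv.prodCongr (Equiv.refl (Fin N)) finSumFinEquiv.symm).trans (Equiv.prodSumDistrib (Fin N) (Fin 1) (Fin 1))).trans ((Equiv.sumCongr e e).trans finSumFinEquiv)) (TV.map (algebraMap F E)) ((Matrix.reindex finSumFinEquiv finSumFinEquiv (Matrix.fromBlocks TW 0 0 (-TW))).map (algebraMap F E)) hcδ hδ hd hV (twd_isSymm F TW hW) rfl rfl).comp ((UnitaryGroup.adelicInr F E c N (1 + 1) (TV.map (algebraMap F E)) ((Matrix.reindex finSumFinEquiv finSumFinEquiv (Matrix.fromBlocks TW 0 0 (-TW))).map (algebraMap F E))).comp (UnitaryGroup.toAdelic F E c (1 + 1) ((Matrix.reindex finSumFinEquiv finSumFinEquiv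 (Matrix.fromBlocks TW 0 0 (-TW))).map (algebraMap F E)))))) wh = ((symplecticGroup (polar (adelicForm F (Fin (n + n)) (doubledGramFin F (adelicGram F e TV TW))))).subtype.comp (ratSp F (doubledGramFin F (adelicGram F e TV TW)) (isUnit_det_doubledGramFin F _ (isUnit_det_adelicGram F e hVd hWd)))) (h : Matrix.symplecticGroup (Fin (n + n)) F) from h.2).elim fun wh hwh => ?_
    have hmemf : (wh : GL (Fin (1 + 1)) E) ∈ unitaryGroupOfForm (c : E →+* E) (UnitaryGroup.finSum 1 1 (TW.map (algebraMap F E)) (-(TW.map (algebraMap F E)))) := (SetLike.ext_iff.1 hUeq _).1 wh.2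
    have horb := DoubledUnitary.existsUnique_isSiegelReindex_blockDiagFin_inv_mul_of_rank_one hSu
      (⟨(wh : GL (Fin (1 + 1)) E), hmemf⟩ : unitaryGroupOfForm (c : E →+* E) (UnitaryGroup.finSum 1 1 (TW.map (algebraMap F E)) (-(TW.map (algebraMap F E)))))
    refine horb.exists.elim fun γ₀ hγ₀ => ?_
    have hγmem : UnitaryGroup.toAdelic F E c 1 (TW.map (algebraMap F E)) γ₀ ∈ (UnitaryGroup.toAdelic F E c 1 (TW.map (algebraMap F E))).range := MonoidHom.mem_range.2 ⟨γ₀, rfl⟩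
    suffices key : ∀ γ : (UnitaryGroup.toAdelic F E c 1 (TW.map (algebraMap F E))).range, γF γ = γ₀ → (QuotientGroup.mk (mW γ) : (((((symplecticGroup (polar (adelicForm F (Fin (n + n)) (adelicGram F (((Equiv.prodCongr (Equiv.refl (Fin N)) finSumFinEquiv.symm).trans (Equiv.prodSumDistrib (Fin N) (Fin 1) (Fin 1))).trans ((Equiv.sumCongr e e).trans finSumFinEquiv)) TV (Matrix.reindex finSumFinEquiv finSumFinEquiv (Matrix.fromBlocks TW 0 0 (-TW))))))).subtype.comp ((toSp F E c N (1 + 1) (((Equiv.prodCongr (Equiv.refl (Fin N)) finSumFinEquiv.symm).trans (Equiv.prodSumDistrib (Fin N) (Fin 1) (Fin 1))).trans ((Equiv.sumCongr e e).trans finSumFinEquiv)) (TV.map (algebraMap F E)) ((Matrix.reindex finSumFinEquiv finSumFinEquiv (Matrix.fromBlocks TW 0 0 (-TW))).map (algebraMap F E)) hcδ hδ hd hV (twd_isSymm F TW hW) rfl rfl).comp ((UnitaryGroup.adelicInr F E c N (1 + 1) (TV.map (algebraMap F E)) ((Matrix.reindex finSumFinEquiv finSumFinEquiv (Matrix.fromBlocks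 TW 0 0 (-TW))).map (algebraMap F E))).comp (UnitaryGroup.toAdelic F E c (1 + 1) ((Matrix.reindex finSumFinEquiv finSumFinEquiv (Matrix.fromBlocks TW 0 0 (-TW))).map (algebraMap F E)))))).range).comap ((symplecticGroup (polar (adelicForm F (Fin (n + n)) (doubledGramFin F (adelicGram F e TV TW))))).subtype.comp (ratSp F (doubledGramFin F (adelicGram F e TV TW)) (isUnit_det_doubledGramFin F _ (isUnit_det_adelicGram F e hVd hWd))))) ⧸ (((siegelParabolicPi (doubledGramFin F (adelicGram F e TV TW))).comap (ratSp F (doubledGramFin F (adelicGram F e TV TW)) (isUnit_det_doubledGramFin F _ (isUnit_det_adelicGram F e hVd hWd)))).comap (MulAut.conj (doublingDeltaRat F (n := n))).toMonoidHom).subgroupOf ((((symplecticGroup (polar (adelicForm F (Fin (n + n)) (adelicGram F (((Equiv.prodCongr (Equiv.refl (Fin N)) finSumFinEquiv.symm).trans (Equiv.prodSumDistrib (Fin N) (Fin 1) (Fin 1))).trans ((Equiv.sumCongr e e).trans finSumFinEquiv)) TV (Matrix.reindex finSumFinEquiv finSumFinEquiv (Matrix.fromBlocks TW 0 0 (-TW))))))).subtype.comp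 ((toSp F E c N (1 + 1) (((Equiv.prodCongr (Equiv.refl (Fin N)) finSumFinEquiv.symm).trans (Equiv.prodSumDistrib (Fin N) (Fin 1) (Fin 1))).trans ((Equiv.sumCongr e e).trans finSumFinEquiv)) (TV.map (algebraMap F E)) ((Matrix.reindex finSumFinEquiv finSumFinEquiv (Matrix.fromBlocks TW 0 0 (-TW))).map (algebraMap F E)) hcδ hδ hd hV (twd_isSymm F TW hW) rfl rfl).comp ((UnitaryGroup.adelicInr F E c N (1 + 1) (TV.map (algebraMap F E)) ((Matrix.reindex finSumFinEquiv finSumFinEquiv (Matrix.fromBlocks TW 0 0 (-TW))).map (algebraMap F E))).comp (UnitaryGroup.toAdelic F E c (1 + 1) ((Matrix.reindex finSumFinEquiv finSumFinEquiv (Matrix.fromBlocks TW 0 0 (-TW))).map (algebraMap F E)))))).range).comap ((symplecticGroup (polar (adelicForm F (Fin (n + n)) (doubledGramFin F (adelicGram F e TV TW))))).subtype.comp (ratSp F (doubledGramFin F (adelicGram F e TV TW)) (isUnit_det_doubledGramFin F _ (isUnit_det_adelicGram F e hVd hWd))))))) = QuotientGroup.mk h by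
      exact ⟨⟨UnitaryGroup.toAdelic F E c 1 (TW.map (algebraMap F E)) γ₀, hγmem⟩,
        (key _ (UnitaryGroup.toAdelic_injective F E c 1 (TW.map (algebraMap F E)) (hγF _))).trans hq⟩
    intro γ hγ0
    apply QuotientGroup.eq.2
    rw [Subgroup.mem_subgroupOf]
    refine (coe_inv_mul_mem_comap_conj_iff (ratSp F (doubledGramFin F (adelicGram F e TV TW)) (isUnit_det_doubledGramFin F _ (isUnit_det_adelicGram F e hVd hWd))) (siegelParabolicPi (doubledGramFin F (adelicGram F e TV TW))) (doublingDeltaRat F) _ (mW γ) h).2 ?_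
    rw [hmW]
    have hconj : (ratSp F (doubledGramFin F (adelicGram F e TV TW)) (isUnit_det_doubledGramFin F _ (isUnit_det_adelicGram F e hVd hWd)) (doublingDeltaRat F)) * (ratSp F (doubledGramFin F (adelicGram F e TV TW)) (isUnit_det_doubledGramFin F _ (isUnit_det_adelicGram F e hVd hWd)) ((m γ)⁻¹ * (h : Matrix.symplecticGroup (Fin (n + n)) F))) * ((ratSp F (doubledGramFin F (adelicGram F e TV TW)) (isUnit_det_doubledGramFin F _ (isUnit_det_adelicGram F e hVd hWd)) (doublingDeltaRat F)))⁻¹ = (UnitaryGroup.spReindex finSumFinEquiv (Matrix.fromBlocks (adelicGram F e TV TW) 0 0 (-(adelicGram F e TV TW))) (doublingDelta (adelicGram F e TV TW) (isUnit_det_adelicGram F e hVd hWd))) * (ratSp F (doubledGramFin F (adelicGram F e TV TW)) (isUnit_det_doubledGramFin F _ (isUnit_det_adelicGram F e hVd hWd)) ((m γ)⁻¹ * (h : Matrix.symplecticGroup (Fin (n + n)) F))) * ((UnitaryGroup.spReindex finSumFinEquiv (Matrix.fromBlocks (adelicGram F e TV TW) 0 0 (-(adelicGram F e TV TW))) (doublingDelta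 (adelicGram F e TV TW) (isUnit_det_adelicGram F e hVd hWd))))⁻¹ := by
      rw [ratSp_doublingDeltaRat F (adelicGram F e TV TW) (isUnit_det_adelicGram F e hVd hWd)]
    rw [hconj]
    have hXw := map_inv_mul_of_eq ((symplecticGroup (polar (adelicForm F (Fin (n + n)) (doubledGramFin F (adelicGram F e TV TW))))).subtype.comp (ratSp F (doubledGramFin F (adelicGram F e TV TW)) (isUnit_det_doubledGramFin F _ (isUnit_det_adelicGram F e hVd hWd)))) ((symplecticGroup (polar (adelicForm F (Fin (n + n)) (adelicGram F (((Equiv.prodCongr (Equiv.refl (Fin N)) finSumFinEquiv.symm).trans (Equiv.prodSumDistrib (Fin N) (Fin 1) (Fin 1))).trans ((Equiv.sumCongr e e).trans finSumFinEquiv)) TV (Matrix.reindex finSumFinEquiv finSumFinEquiv (Matrix.fromBlocks TW 0 0 (-TW))))))).subtype.comp ((toSp F E c N (1 + 1) (((Equiv.prodCongr (Equiv.refl (Fin N)) finSumFinEquiv.symm).trans (Equiv.prodSumDistrib (Fin N) (Fin 1) (Fin 1))).trans ((Equiv.sumCongr e e).trans finSumFinEquiv)) (TV.map (algebraMap F E))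 ((Matrix.reindex finSumFinEquiv finSumFinEquiv (Matrix.fromBlocks TW 0 0 (-TW))).map (algebraMap F E)) hcδ hδ hd hV (twd_isSymm F TW hW) rfl rfl).comp ((UnitaryGroup.adelicInr F E c N (1 + 1) (TV.map (algebraMap F E)) ((Matrix.reindex finSumFinEquiv finSumFinEquiv (Matrix.fromBlocks TW 0 0 (-TW))).map (algebraMap F E))).comp (UnitaryGroup.toAdelic F E c (1 + 1) ((Matrix.reindex finSumFinEquiv finSumFinEquiv (Matrix.fromBlocks TW 0 0 (-TW))).map (algebraMap F E)))))) (hm γ) hwh.symm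
    have hXw' := map_inv_of_eq ((symplecticGroup (polar (adelicForm F (Fin (n + n)) (doubledGramFin F (adelicGram F e TV TW))))).subtype.comp (ratSp F (doubledGramFin F (adelicGram F e TV TW)) (isUnit_det_doubledGramFin F _ (isUnit_det_adelicGram F e hVd hWd)))) ((symplecticGroup (polar (adelicForm F (Fin (n + n)) (adelicGram F (((Equiv.prodCongr (Equiv.refl (Fin N)) finSumFinEquiv.symm).trans (Equiv.prodSumDistrib (Fin N) (Fin 1) (Fin 1))).trans ((Equiv.sumCongr e e).trans finSumFinEquiv)) TV (Matrix.reindex finSumFinEquiv finSumFinEquiv (Matrix.fromBlocks TW 0 0 (-TW))))))).subtype.comp ((toSp F E c N (1 + 1) (((Equiv.prodCongr (Equiv.refl (Fin N)) finSumFinEquiv.symm).trans (Equiv.prodSumDistrib (Fin N) (Fin 1) (Fin 1))).trans ((Equiv.sumCongr e e).trans finSumFinEquiv)) (TV.map (algebraMap F E)) ((Matrix.reindex finSumFinEquiv finSumFinEquiv (Matrix.fromBlocks TW 0 0 (-TW))).map (algebraMap F E)) hcδ hδ hd hV (twd_isSymm F TW hW) rfl rfl).comp ((UnitaryGroup.adelicInr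 F E c N (1 + 1) (TV.map (algebraMap F E)) ((Matrix.reindex finSumFinEquiv finSumFinEquiv (Matrix.fromBlocks TW 0 0 (-TW))).map (algebraMap F E))).comp (UnitaryGroup.toAdelic F E c (1 + 1) ((Matrix.reindex finSumFinEquiv finSumFinEquiv (Matrix.fromBlocks TW 0 0 (-TW))).map (algebraMap F E)))))) hXw
    have hGL : (((w γ)⁻¹ * wh : UnitaryGroup.rational F E c (1 + 1) ((Matrix.reindex finSumFinEquiv finSumFinEquiv (Matrix.fromBlocks TW 0 0 (-TW))).map (algebraMap F E))) : GL (Fin (1 + 1)) E) =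
        ((((UnitaryGroup.blockDiagFin (c : E →+* E) (TW.map (algebraMap F E)) (-(TW.map (algebraMap F E)))) (γ₀, 1) : unitaryGroupOfForm (c : E →+* E) (UnitaryGroup.finSum 1 1 (TW.map (algebraMap F E)) (-(TW.map (algebraMap F E))))) : GL (Fin (1 + 1)) E))⁻¹ * (wh : GL (Fin (1 + 1)) E) := by
      show ((w γ : GL (Fin (1 + 1)) E))⁻¹ * (wh : GL (Fin (1 + 1)) E) = _
      rw [hw, hγ0]
    have hS : DoubledUnitary.IsSiegelReindex finSumFinEquiv
        ((((w γ)⁻¹ * wh : UnitaryGroup.rational F E c (1 + 1) ((Matrix.reindex finSumFinEquiv finSumFinEquiv (Matrix.fromBlocks TW 0 0 (-TW))).map (algebraMap F E))) : GL (Fin (1 + 1)) E)) := by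
      rw [hGL]
      exact hγ₀
    have hrow := (UnitaryGroup.isSiegelReindex_finSumFinEquiv_iff_rowSum _).1 hS
    have hrow' := UnitaryGroup.rowSum_eq_inv _ hrow
    refine UnitaryGroup.conj_doublingDelta_mem_siegelParabolicPi_of_isDiag F (adelicGram F e TV TW) (isUnit_det_adelicGram F e hVd hWd) (ratSp F (doubledGramFin F (adelicGram F e TV TW)) (isUnit_det_doubledGramFin F _ (isUnit_det_adelicGram F e hVd hWd)) ((m γ)⁻¹ * (h : Matrix.symplecticGroup (Fin (n + n)) F))) (fun u hu => ?_) (fun u hu => ?_)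
    · rw [show (((ratSp F (doubledGramFin F (adelicGram F e TV TW)) (isUnit_det_doubledGramFin F _ (isUnit_det_adelicGram F e hVd hWd)) ((m γ)⁻¹ * (h : Matrix.symplecticGroup (Fin (n + n)) F))) : (symplecticGroup (polar (adelicForm F (Fin (n + n)) (doubledGramFin F (adelicGram F e TV TW)))))) : (((Fin (n + n) → AdeleRing (𝓞 F) F) × (Fin (n + n) → AdeleRing (𝓞 F) F)) ≃ₗ[AdeleRing (𝓞 F) F] ((Fin (n + n) → AdeleRing (𝓞 F) F) × (Fin (n + n) → AdeleRing (𝓞 F) F)))) = _ from hXw]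
      exact UnitaryGroup.isDiag_toSp_doubled_rationalInr F E c hcδ hδ hd N e hV (twd_isSymm F TW hW) _ hrow u hu
    · change Literature.NumberTheory.Weil1964.IsDiag ((UnitaryGroup.reindexW (AdeleRing (𝓞 F) F) finSumFinEquiv).symm
        (((((ratSp F (doubledGramFin F (adelicGram F e TV TW)) (isUnit_det_doubledGramFin F _ (isUnit_det_adelicGram F e hVd hWd)) ((m γ)⁻¹ * (h : Matrix.symplecticGroup (Fin (n + n)) F))))⁻¹ : (symplecticGroup (polar (adelicForm F (Fin (n + n)) (doubledGramFin F (adelicGram F e TV TW)))))) : (((Fin (n + n) → AdeleRing (𝓞 F) F) × (Fin (n + n) → AdeleRing (𝓞 F) F)) ≃ₗ[AdeleRing (𝓞 F) F] ((Fin (n + n) → AdeleRing (𝓞 F) F) × (Fin (n + n) → AdeleRing (𝓞 F) F)))) (UnitaryGroup.reindexW (AdeleRing (𝓞 F) F) finSumFinEquiv u)))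
      rw [← (ratSp F (doubledGramFin F (adelicGram F e TV TW)) (isUnit_det_doubledGramFin F _ (isUnit_det_adelicGram F e hVd hWd))).map_inv,
        show (((ratSp F (doubledGramFin F (adelicGram F e TV TW)) (isUnit_det_doubledGramFin F _ (isUnit_det_adelicGram F e hVd hWd)) ((m γ)⁻¹ * (h : Matrix.symplecticGroup (Fin (n + n)) F))⁻¹) : (symplecticGroup (polar (adelicForm F (Fin (n + n)) (doubledGramFin F (adelicGram F e TV TW)))))) : (((Fin (n + n) → AdeleRing (𝓞 F) F) × (Fin (n + n) → AdeleRing (𝓞 F) F)) ≃ₗ[AdeleRing (𝓞 F) F] ((Fin (n + n) → AdeleRing (𝓞 F) F) × (Fin (n + n) → AdeleRing (𝓞 F) F)))) = _ from hXw']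
      exact UnitaryGroup.isDiag_toSp_doubled_rationalInr F E c hcδ hδ hd N e hV (twd_isSymm F TW hW) _ hrow' u hu
  · -- EQUIVARIANT: `r_F^□(m γ)` lies over `ι(1 ⊗ γ) ⊕ 1`, so it acts through the first tensor factor, where `s(1, γ) = r_F`
    refine (MonoidHom.mem_range.1 (toSp_rationalPairToAdelic_mem_range F E c N 1 e (TV.map (algebraMap F E)) (TW.map (algebraMap F E)) hcδ hδ hd hV hW hVd hWd
      rfl rfl (UnitaryGroup.rationalInr F E c N 1 (TV.map (algebraMap F E)) (TW.map (algebraMap F E)) (γF γ)))).elim fun x₁ hx₁ => ?_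
    have hK0 := UnitaryGroup.coe_toSp_doubled_eq_spReindex_spSum F E c hcδ hδ hd N e hV hW (twd_isSymm F TW hW) (γF γ) (w γ) (hwM γ)
    have hx : ratSp F (doubledGramFin F (adelicGram F e TV TW)) (isUnit_det_doubledGramFin F _ (isUnit_det_adelicGram F e hVd hWd)) (m γ) =
        UnitaryGroup.spReindex finSumFinEquiv (Matrix.fromBlocks (adelicGram F e TV TW) 0 0 (-(adelicGram F e TV TW))) (UnitaryGroup.spSum (adelicGram F e TV TW) (-(adelicGram F e TV TW)) (ratSp F (adelicGram F e TV TW) (isUnit_det_adelicGram F e hVd hWd) x₁, 1)) := by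
      apply Subtype.ext
      refine (hm γ).trans (hK0.trans ?_)
      rw [UnitaryGroup.adelicInr_toAdelic, ← hx₁]
    -- `s(1, γ) = r_F(x₁)` (compatibility at the rational point `γ = γF γ`)
    have hmemR : UnitaryGroup.adelicInr F E c N 1 (TV.map (algebraMap F E)) (TW.map (algebraMap F E)) (γ : UnitaryGroup.adelic F E c 1 (TW.map (algebraMap F E))) ∈
        (splittingDatum F E c N 1 e (TV.map (algebraMap F E)) (TW.map (algebraMap F E)) hcδ hδ hd hV hW hVd hWd rfl rfl).ratPts := by
      rw [splittingDatum_ratPts]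
      exact MonoidHom.mem_range.2 ⟨UnitaryGroup.rationalInr F E c N 1 (TV.map (algebraMap F E)) (TW.map (algebraMap F E)) (γF γ),
        (UnitaryGroup.adelicInr_toAdelic F E c N 1 (TV.map (algebraMap F E)) (TW.map (algebraMap F E)) (γF γ)).symm.trans
          (congrArg (UnitaryGroup.adelicInr F E c N 1 (TV.map (algebraMap F E)) (TW.map (algebraMap F E))) (hγF γ))⟩
    have hsplit : ∀ (y : (splittingDatum F E c N 1 e (TV.map (algebraMap F E)) (TW.map (algebraMap F E)) hcδ hδ hd hV hW hVd hWd rfl rfl).spRat),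
        (y : symplecticGroup (polar (adelicForm F (Fin n) (adelicGram F e TV TW)))) = ratSp F (adelicGram F e TV TW) (isUnit_det_adelicGram F e hVd hWd) x₁ →
        (splittingDatum F E c N 1 e (TV.map (algebraMap F E)) (TW.map (algebraMap F E)) hcδ hδ hd hV hW hVd hWd rfl rfl).ratSplit y = ratThetaLiftCont F (adelicGram F e TV TW) (isUnit_det_adelicGram F e hVd hWd) x₁ := by
      intro y hy
      have hy' : y = ⟨ratSp F (adelicGram F e TV TW) (isUnit_det_adelicGram F e hVd hWd) x₁, x₁, rfl⟩ := Subtype.ext hy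
      rw [hy']
      exact ratSection_apply F (adelicGram F e TV TW) (isUnit_det_adelicGram F e hVd hWd) x₁
    have htoSp : toSp F E c N 1 e (TV.map (algebraMap F E)) (TW.map (algebraMap F E)) hcδ hδ hd hV hW rfl rfl
        (UnitaryGroup.adelicInr F E c N 1 (TV.map (algebraMap F E)) (TW.map (algebraMap F E)) (γ : UnitaryGroup.adelic F E c 1 (TW.map (algebraMap F E)))) = ratSp F (adelicGram F e TV TW) (isUnit_det_adelicGram F e hVd hWd) x₁ :=
      (congrArg (fun z => toSp F E c N 1 e (TV.map (algebraMap F E)) (TW.map (algebraMap F E)) hcδ hδ hd hV hW rfl rfl (UnitaryGroup.adelicInr F E c N 1 (TV.map (algebraMap F E)) (TW.map (algebraMap F E)) z))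
        (hγF γ)).symm.trans
        ((congrArg (toSp F E c N 1 e (TV.map (algebraMap F E)) (TW.map (algebraMap F E)) hcδ hδ hd hV hW rfl rfl)
          (UnitaryGroup.adelicInr_toAdelic F E c N 1 (TV.map (algebraMap F E)) (TW.map (algebraMap F E)) (γF γ))).trans hx₁.symm)
    have hsγ : s (UnitaryGroup.adelicInr F E c N 1 (TV.map (algebraMap F E)) (TW.map (algebraMap F E)) (γ : UnitaryGroup.adelic F E c 1 (TW.map (algebraMap F E)))) = ratThetaLiftCont F (adelicGram F e TV TW) (isUnit_det_adelicGram F e hVd hWd) x₁ :=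
      (hs.apply_eq_ratSplit hmemR).trans (hsplit _ htoSp)
    have h11 : (UnitaryGroup.adelicInl F E c N 1 (TV.map (algebraMap F E)) (TW.map (algebraMap F E))) 1 * (UnitaryGroup.adelicInr F E c N 1 (TV.map (algebraMap F E)) (TW.map (algebraMap F E))) (γ : UnitaryGroup.adelic F E c 1 (TW.map (algebraMap F E))) = (UnitaryGroup.adelicInr F E c N 1 (TV.map (algebraMap F E)) (TW.map (algebraMap F E))) (γ : UnitaryGroup.adelic F E c 1 (TW.map (algebraMap F E))) :=
      (congrArg (· * (UnitaryGroup.adelicInr F E c N 1 (TV.map (algebraMap F E)) (TW.map (algebraMap F E))) (γ : UnitaryGroup.adelic F E c 1 (TW.map (algebraMap F E)))) (map_one (UnitaryGroup.adelicInl F E c N 1 (TV.map (algebraMap F E)) (TW.map (algebraMap F E))))).trans (one_mul _)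
    have hpair : (pairRep F E c N 1 e (TV.map (algebraMap F E)) (TW.map (algebraMap F E)) s) (1, (γ : UnitaryGroup.adelic F E c 1 (TW.map (algebraMap F E)))) Φ₁ =
        adelicMpCont.omega F (Fin n) (adelicGram F e TV TW) (s (UnitaryGroup.adelicInr F E c N 1 (TV.map (algebraMap F E)) (TW.map (algebraMap F E)) (γ : UnitaryGroup.adelic F E c 1 (TW.map (algebraMap F E))))) Φ₁ :=
      congrArg (fun t => adelicMpCont.omega F (Fin n) (adelicGram F e TV TW) (s t) Φ₁) h11
    have hfin : adelicMpCont.omega F (Fin n) (adelicGram F e TV TW) (ratThetaLiftCont F (adelicGram F e TV TW) (isUnit_det_adelicGram F e hVd hWd) x₁) Φ₁ = (pairRep F E c N 1 e (TV.map (algebraMap F E)) (TW.map (algebraMap F E)) s) (1, (γ : UnitaryGroup.adelic F E c 1 (TW.map (algebraMap F E)))) Φ₁ :=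
      (congrArg (fun t => adelicMpCont.omega F (Fin n) (adelicGram F e TV TW) t Φ₁) hsγ).symm.trans hpair.symm
    rw [hmW]
    exact (omega_ratThetaLiftCont_boxConj F (adelicGram F e TV TW) (isUnit_det_adelicGram F e hVd hWd) (m γ) x₁ hx Φ₁ Φ₂).trans (congrArg (fun t => piSBReindex F finSumFinEquiv
      (tensorToSum F (Fin n) (Fin n) t (piSchwartzBruhatConj F (Fin n) Φ₂))) hfin)

end Summit.HodgeConjecture.HodgeConjecture.Cruxes.H413.E2SWOrbit
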